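import Summits.AnomalousDissipation.AnomalousDissipation.Theses.StirringSphere
import Literature.Analysis.FluidPDE.StatisticalSolutionDirac

/-!
# Strategist sketch — crux `NoScreening` (stmt-AnomalousDissipation-17144), NEGATION lens:
# the Klein-pole reduction and quiet Euler-balanced steady states

Typed first lemmas of the negation programme (idea `klein-pole-quiet-states`). Everything here only
has to ELABORATE; `sorry` marks what a disprover / prover would supply.

* `stirB` — the route's explicit triple `![b₀, b₁, b₂]` (byte-identical literal).
* `polarForce` — the pole `c⁻ = −e₂` of the stirring sphere, force `f_{c⁻} = Σ c⁻ᵢ bᵢ = −b₂`.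
* `not_noScreening_of_steadyMixtures` — FIRST LEMMA (provable now from
  `IsSteadyWeakSolution.isStationaryStatisticalSolution_dirac` + convexity of the Foias–Prodi class):
  finite mixtures of Dirac masses at bounded steady states refute the crux as soon as the convex hull of
  their response vectors `Y(u) = ((u,bᵢ))ᵢ` enters the `m₀`-ball.
* `PolarKleinOrbit` — (provable now, L) at the pole the Klein group `{1,P,T,PT}` (`P u = −u(−·)`,
  `T u = u(· − (½,½,½))`) maps steady states to steady states and averages `b₀, b₁` to zero.
* `QuietPolarSteadyStates` — (OPEN, the negation's real content) bounded steady states of `NS_ν(−b₂)`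
  with vanishing dissipation along `ν → 0`.
* `not_noScreening_of_polar` — composition: `PolarKleinOrbit → QuietPolarSteadyStates → ¬NoScreening`
  (proved here from the first lemma).
* `EulerBalancedPole` — (provable now, M/L) the explicit smooth state `u* = (2π)^{-1/2}(b₁ + b₁')`
  is a steady weak solution of forced EULER (`ν = 0`) with force `−b₂`: the `ν = 0` end of
  `QuietPolarSteadyStates` exists.
-/

set_option linter.dupNamespace false

noncomputable section

open MeasureTheory
open scoped BigOperators Real

namespace Summit.AnomalousDissipation.AnomalousDissipation.Cruxes.NoScreening.KleinPole

local notation "𝕋³" => UnitAddTorus (Fin 3)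
local notation "E³" => EuclideanSpace ℝ (Fin 3)
local notation "L2T" => Lp (EuclideanSpace ℝ (Fin 3)) 2 (volume : Measure (UnitAddTorus (Fin 3)))
local notation "H" => Literature.Analysis.FunctionSpaces.Torus.energySpace (Fin 3)

/-- The route's stirring triple `![b₀, b₁, b₂]` (literal of the route file). -/
def stirB : Fin 3 → 𝕋³ → E³ :=
  ![(fun x : UnitAddTorus (Fin 3) => (Literature.Analysis.FluidPDE.Torus.stokesMode (Pi.single (2 : Fin 3) (1 : ℤ)) (EuclideanSpace.single (0 : Fin 3) (1 : ℝ)) false x + Literature.Analysis.FluidPDE.Torus.stokesMode (Pi.single (0 : Fin 3) (1 : ℤ)) (EuclideanSpace.single (1 : Fin 3) (1 : ℝ)) false x + Literature.Analysis.FluidPDE.Torus.stokesMode (Pi.single (1 : Fin 3) (1 : ℤ)) (EuclideanSpace.single (2 : Fin 3) (1 : ℝ)) false x : EuclideanSpace ℝ (Fin 3))), (fun x : UnitAddTorus (Fin 3) => (Literature.Analysis.FluidPDE.Torus.stokesMode (Pi.single (1 : Fin 3) (1 : ℤ)) (EuclideanSpace.single (0 : Fin 3) (1 : ℝ)) true x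 + Literature.Analysis.FluidPDE.Torus.stokesMode (Pi.single (2 : Fin 3) (1 : ℤ)) (EuclideanSpace.single (1 : Fin 3) (1 : ℝ)) true x + Literature.Analysis.FluidPDE.Torus.stokesMode (Pi.single (0 : Fin 3) (1 : ℤ)) (EuclideanSpace.single (2 : Fin 3) (1 : ℝ)) true x : EuclideanSpace ℝ (Fin 3))), (fun x : UnitAddTorus (Fin 3) => (Literature.Analysis.FluidPDE.Torus.stokesMode ![(0 : ℤ), 1, 1] (EuclideanSpace.single (0 : Fin 3) (1 : ℝ)) false x + Literature.Analysis.FluidPDE.Torus.stokesMode ![(1 : ℤ), 0, 1] (EuclideanSpace.single (1 : Fin 3) (1 : ℝ)) false x + Literature.Analysis.FluidPDE.Torus.stokesMode ![(1 : ℤ), 1, 0] (EuclideanSpace.single (2 : Fin 3) (1 : ℝ)) false x : EuclideanSpace ℝ (Fin 3)))]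

/-- The anti-cyclic cosine partner OUTSIDE `V`: `b₁' = cos θ₃ e₁ + cos θ₁ e₂ + cos θ₂ e₃`. -/
def b1' : 𝕋³ → E³ := fun x =>
  (Literature.Analysis.FluidPDE.Torus.stokesMode (Pi.single (2 : Fin 3) (1 : ℤ)) (EuclideanSpace.single (0 : Fin 3) (1 : ℝ)) true x +
    Literature.Analysis.FluidPDE.Torus.stokesMode (Pi.single (0 : Fin 3) (1 : ℤ)) (EuclideanSpace.single (1 : Fin 3) (1 : ℝ)) true x +
    Literature.Analysis.FluidPDE.Torus.stokesMode (Pi.single (1 : Fin 3) (1 : ℤ)) (EuclideanSpace.single (2 : Fin 3) (1 : ℝ)) true x : E³)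

/-- The force of the sphere at `c`: `f_c = Σ cᵢ bᵢ` (the crux's own expression). -/
def sphereForce (b : Fin 3 → 𝕋³ → E³) (c : E³) : 𝕋³ → E³ := fun x => ∑ i : Fin 3, c i • b i x

/-- The (south) pole of the stirring sphere, `c⁻ = −e₂`; `f_{c⁻} = −b₂`. -/
def polarC : E³ := -EuclideanSpace.single (2 : Fin 3) (1 : ℝ)

/-- A bounded steady state of `NS_ν(f)` in the sense needed by the tree's Dirac lemma: `u ∈ V`, steady
weak solution, and the energy inequality `ν‖∇u‖² ≤ (f,u)` (an equality for `u ∈ V`, Temam). -/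
def IsAdmissibleSteadyState (ν : ℝ) (f : 𝕋³ → E³) (u : H) : Prop :=
  ((u : L2T) ∈ Literature.Analysis.FunctionSpaces.Torus.energySpaceV (Fin 3)) ∧
    Literature.Analysis.FluidPDE.Torus.IsSteadyWeakSolution ν f u ∧
    ν * (Literature.Analysis.FunctionSpaces.Torus.eGradNormSq ((u : L2T) : 𝕋³ → E³)).toReal ≤
      Literature.Analysis.FluidPDE.Torus.pairing (u : L2T) f

/-- **First lemma (finite-mixture screening criterion; provable now).** If for some energy level `E`
and every `ν₀, m₀ > 0` there are a unit `c`, a viscosity `ν ∈ (0,ν₀)` and finitely many admissible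
steady states `u_j` of `NS_ν(f_c)` with `‖u_j‖² ≤ E` and convex weights `θ` such that the convex
combination of their response vectors `Y(u_j) = ((u_j, bᵢ))ᵢ` has squared length `< m₀²`, then
`NoScreening` fails: `μ̄ = Σ θ_j δ_{u_j}` is a Foias–Prodi stationary statistical solution
(`IsSteadyWeakSolution.isStationaryStatisticalSolution_dirac` + convexity of the class) with integrable
energy `≤ E` and `y(μ̄) = Σ θ_j Y(u_j)`. -/
theorem not_noScreening_of_steadyMixtures
    (h : ∃ E : ℝ, 0 < E ∧ ∀ ν₀ m₀ : ℝ, 0 < ν₀ → 0 < m₀ →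
      ∃ (c : E³) (ν : ℝ) (n : ℕ) (θ : Fin n → ℝ) (u : Fin n → H),
        ‖c‖ = 1 ∧ 0 < ν ∧ ν < ν₀ ∧ (∀ j, 0 ≤ θ j) ∧ ∑ j, θ j = 1 ∧
        (∀ j, IsAdmissibleSteadyState ν (sphereForce stirB c) (u j) ∧ ‖u j‖ ^ 2 ≤ E) ∧
        ∑ i : Fin 3, (∑ j, θ j * Literature.Analysis.FluidPDE.Torus.pairing (u j : L2T) (stirB i)) ^ 2 < m₀ ^ 2) :
    ¬ Summit.AnomalousDissipation.AnomalousDissipation.Theses.StirringSphere.NoScreening := by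
  sorry

/-- **Klein orbit at the pole (provable now, size L).** `P u := −u(−·)` and `T u := u(· − (½,½,½))`
are symmetries of `NS_ν(−b₂)` (`−b₂` is a sine field of the shell `|k|² = 2`): they map admissible
steady states to admissible steady states of the same norm, and the Klein average of the responses is
polar: `Σ_g (g u, b₀) = Σ_g (g u, b₁) = 0` (`P b₁ = −b₁`, `T b₀ = −b₀`, `T b₁ = −b₁`), `(g u, b₂) = (u, b₂)`.
Stated existentially (the orbit as a `Fin 4`-family) so that no group action on `H` has to be named. -/
def PolarKleinOrbit : Prop :=
  ∀ (ν : ℝ) (u : H), IsAdmissibleSteadyState ν (sphereForce stirB polarC) u →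
    ∃ v : Fin 4 → H,
      (∀ g, IsAdmissibleSteadyState ν (sphereForce stirB polarC) (v g) ∧ ‖v g‖ = ‖u‖) ∧
      ∑ g, Literature.Analysis.FluidPDE.Torus.pairing (v g : L2T) (stirB 0) = 0 ∧
      ∑ g, Literature.Analysis.FluidPDE.Torus.pairing (v g : L2T) (stirB 1) = 0 ∧
      ∀ g, Literature.Analysis.FluidPDE.Torus.pairing (v g : L2T) (stirB 2) =
        Literature.Analysis.FluidPDE.Torus.pairing (u : L2T) (stirB 2)

/-- **Quiet polar steady states (OPEN — the content of the negation).** Along some sequence `ν → 0`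
the force `−b₂` admits admissible steady states of `NS_ν` with energy `≤ E` and arbitrarily small polar
response `|(u, b₂)| = ν‖∇u‖²` (= dissipation, by the energy equality of steady states in `V`).
Candidate: continuation of the Euler-balanced state `u*` of `EulerBalancedPole` (or a layered branch
with dissipation `≲ ν^{1/2}`). -/
def QuietPolarSteadyStates : Prop :=
  ∃ E : ℝ, 0 < E ∧ ∀ ν₀ m₀ : ℝ, 0 < ν₀ → 0 < m₀ →
    ∃ (ν : ℝ) (u : H), 0 < ν ∧ ν < ν₀ ∧ IsAdmissibleSteadyState ν (sphereForce stirB polarC) u ∧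
      ‖u‖ ^ 2 ≤ E ∧ |Literature.Analysis.FluidPDE.Torus.pairing (u : L2T) (stirB 2)| < m₀

/-- **Composition (proved from the first lemma):** the Klein orbit of a quiet polar steady state is a
screened finite mixture. -/
theorem not_noScreening_of_polar (hK : PolarKleinOrbit) (hQ : QuietPolarSteadyStates) :
    ¬ Summit.AnomalousDissipation.AnomalousDissipation.Theses.StirringSphere.NoScreening := by
  apply not_noScreening_of_steadyMixtures
  obtain ⟨E, hE, hQ⟩ := hQ
  refine ⟨E, hE, fun ν₀ m₀ hν₀ hm₀ => ?_⟩
  obtain ⟨ν, u, hν, hνν₀, hu, huE, hquiet⟩ := hQ ν₀ m₀ hν₀ hm₀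
  obtain ⟨v, hv, h0, h1, h2⟩ := hK ν u hu
  refine ⟨polarC, ν, 4, fun _ => (1 / 4 : ℝ), v, ?_, hν, hνν₀, fun _ => by norm_num, by simp, ?_, ?_⟩
  · simp [polarC]
  · intro g
    exact ⟨(hv g).1, by rw [(hv g).2]; exact huE⟩
  · have e0 : ∑ j : Fin 4, (1 / 4 : ℝ) * Literature.Analysis.FluidPDE.Torus.pairing (v j : L2T) (stirB 0) = 0 := by
      rw [← Finset.mul_sum, h0, mul_zero]
    have e1 : ∑ j : Fin 4, (1 / 4 : ℝ) * Literature.Analysis.FluidPDE.Torus.pairing (v j : L2T) (stirB 1) = 0 := by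
      rw [← Finset.mul_sum, h1, mul_zero]
    have e2 : ∑ j : Fin 4, (1 / 4 : ℝ) * Literature.Analysis.FluidPDE.Torus.pairing (v j : L2T) (stirB 2) =
        Literature.Analysis.FluidPDE.Torus.pairing (u : L2T) (stirB 2) := by
      simp_rw [h2]; rw [Finset.sum_const, Finset.card_univ, Fintype.card_fin]; ring
    rw [Fin.sum_univ_three, e0, e1, e2]
    have := sq_lt_sq' (by linarith [abs_lt.1 hquiet]) (abs_lt.1 hquiet).2
    simpa using this

/-- **The pole is Euler-balanced by an explicit smooth bounded state (provable now, size M/L).**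
`u* = (2π)^{-1/2} (b₁ + b₁')`, i.e. `ρ·((cos θ₂ + cos θ₃), (cos θ₃ + cos θ₁), (cos θ₁ + cos θ₂))`,
`2πρ² = 1`, satisfies `(u*·∇)u* + ∇q = −b₂` with `q = ρ²·2π·(S₁S₂ + S₂S₃ + S₃S₁)/(2π)·…` — a steady weak
solution of the FORCED EULER equations (`ν = 0`) with the polar force, of energy `‖u*‖² = 3/(2π)`;
more generally `u_α = ρ(cos α (b₁+b₁') + sin α (b₀ − b₀'))` balances `−cos(2α) b₂`. Hand computation of
the strategist (NOTES.md §Finding), machine-checked pseudo-spectrally in kit job j024184. -/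
def EulerBalancedPole : Prop :=
  ∃ U : H, (((U : L2T) : 𝕋³ → E³) =ᵐ[volume] fun x => (Real.sqrt (2 * π))⁻¹ • (stirB 1 x + b1' x)) ∧
    ((U : L2T) ∈ Literature.Analysis.FunctionSpaces.Torus.energySpaceV (Fin 3)) ∧
    Literature.Analysis.FluidPDE.Torus.IsSteadyWeakSolution 0 (sphereForce stirB polarC) U ∧
    ‖U‖ ^ 2 = 3 / (2 * π)

/-- **The consequence the route should know (provable now from `PolarKleinOrbit`-type covariance for
MEASURES; stated, not proved): at the pole the crux is a UNIVERSAL INJECTION FLOOR over all bounded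
Foias–Prodi statistics.** -/
def PolarUniversalInjectionFloor : Prop :=
  ∀ E : ℝ, 0 < E → ∃ ν₀ m₀ : ℝ, 0 < ν₀ ∧ 0 < m₀ ∧ ∀ ν : ℝ, 0 < ν → ν < ν₀ →
    ∀ μ : Measure H, Literature.Analysis.FluidPDE.Torus.IsStationaryStatisticalSolution ν (sphereForce stirB polarC) μ →
      Integrable (fun u : H => ‖u‖ ^ 2) μ → Literature.Analysis.FluidPDE.Torus.ensembleEnergy μ ≤ E →
        m₀ ≤ ∫ u, Literature.Analysis.FluidPDE.Torus.pairing (u : L2T) (sphereForce stirB polarC) ∂μ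

/-- `NoScreening → PolarUniversalInjectionFloor` (Klein symmetrisation of measures; provable now, L). -/
theorem polarFloor_of_noScreening :
    Summit.AnomalousDissipation.AnomalousDissipation.Theses.StirringSphere.NoScreening → PolarUniversalInjectionFloor := by
  sorry

end Summit.AnomalousDissipation.AnomalousDissipation.Cruxes.NoScreening.KleinPole

end
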